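import Summits.CriticalPhenomena.Ising3DConformalLimit.Theses.CoerciveSharpness
import Summits.CriticalPhenomena.Ising3DConformalLimit.Theses.LatticeSDPCertificates
import Summits.CriticalPhenomena.Ising3DConformalLimit.Theorems.EnergyNotSigmaSquaredGapForcesFarMergingSandwichFarMergingSpins
import Summits.CriticalPhenomena.Ising3DConformalLimit.Theorems.FKParityRobustnessFarMergingGivesU4
import Summits.CriticalPhenomena.Ising3DConformalLimit.Theorems.IsingEuclidUpgradeR4NonGaussianDefs
import Summits.CriticalPhenomena.Ising3DConformalLimit.Theorems.LatticeSDPCertificatesWindowForcesU4WindowDuplicatedMeeting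
import Literature.Probability.LatticeModels.BackboneChainRule
import Literature.Probability.LatticeModels.SourcedCurrentLaw
import Summits.CriticalPhenomena.Ising3DConformalLimit.Theorems.LatticeSDPCertificatesWindowForcesU4ThetaBubble
import Summits.CriticalPhenomena.Ising3DConformalLimit.Theorems.LatticeSDPCertificatesWindowForcesU4BackboneCauchySchwarz
import Summits.CriticalPhenomena.Ising3DConformalLimit.Theorems.LatticeSDPCertificatesWindowForcesU4BackboneDensityDictionary
import Summits.CriticalPhenomena.Ising3DConformalLimit.Theorems.LatticeSDPCertificatesWindowForcesU4BackboneMomentComparison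
import Summits.CriticalPhenomena.Ising3DConformalLimit.Theorems.LatticeSDPCertificatesWindowForcesU4MergeOfBackbonesMeet
import HarnessLib

/-!
# Line `backbone-thinning-window` — ALTERNATIVE skeleton for crux `WindowForcesU4`
# (item stmt-CriticalPhenomena-5505; routes CoerciveSharpness r5 / LatticeSDPCertificates r3)

Crux BY NAME: `Summit.CriticalPhenomena.Ising3DConformalLimit.Theses.CoerciveSharpness.WindowForcesU4`
(and the `LatticeSDPCertificates` copy, syntactically the same statement):
`WINDOW → ∀ ρ S, (ρ > 0 on (0,1]) → HasPointwiseScalingLimit (criticalCorr 3) ρ S →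
IsNondegenerateTwoPoint S → HasNontrivialU4 S`, WINDOW = `∃ ε c > 0, ∀ 1 ≤ m ≤ n,
c (n/m)^{-(3/2-ε)} G(m e₁) ≤ G(n e₁)`.

Filed by the crux strategist (seat `cstrat-stmt-CriticalPhenomena-5505-b1`, 2026-08-17) as an
ALTERNATIVE to the live line `Lines/birth.lean` (whose one open stub B =
`stub_windowLatticeMeetingRobustness` compares two four-source current laws, `c·meet ≤ merge`, with no
monotone structure between them). This line never compares `meet` with `merge`.

## The line: Paley–Zygmund AT THE SINGLE-CURRENT SCALE, with the window's exponent as the room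

Aizenman's identity makes `-U₄ = 2⟨σσ⟩⟨σσ⟩·P^{ab}⊗P^{a'b'}[a ↔ a' in n₁+n₂]`, and
`{a ↔ a' in n₁+n₂} ⊇ {Γ(n₁) ∩ Γ(n₂) ≠ ∅}`: it suffices that the BACKBONES (Aizenman 1982 §9 walks,
tree `Current.explore rk n {b} a`, visited set `.vis`) of two INDEPENDENT single sourced critical
currents, sources `(0, 4Le₁)` and `(2Le₁+3Le₂, 2Le₁-3Le₂)`, share a vertex with probability `≥ c₀`
uniformly in `L` (`stub_mergeOfBackbonesMeet`, provable: visited sites hang on the start through odd,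
hence open, bonds). The one-point law of ONE backbone has an exact chain rule (tree, PROVED:
`Current.tsum_backboneVisits_mul_le`, `P^{ab}[u ∈ Γ] ≤ K(u) := ⟨σ_aσ_u⟩⟨σ_uσ_b⟩/⟨σ_aσ_b⟩`), so the
second-moment method can be run ENTIRELY at the single-current scale: if the backbone is THINNER than
the duplicated cluster by a two-sided power `L^{-θ}` — one-point `P[u ∈ Γ] ≥ c L^{-θ} K(u)` and
two-point `P[u,v ∈ Γ] ≤ C L^{-θ}‖u-v‖^{-θ}·(K-chain)` at macroscopic `u, v` (`stub_backboneExponent`,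
the regularity half) — then `E N ≍ L^{3-2θ}G(L)²` and, by WINDOW's top-heavy bubble with room `ε`
(`Σ_{|w|≤L} G(w)²|w|^{-2θ} ≤ C_ε G(L)² L^{3-2θ}` as soon as `θ < ε`), `E N² ≲ (E N)²`: Paley–Zygmund
gives `P[Γ₁ ∩ Γ₂ ≠ ∅] ≥ c₀(θ, ε) > 0` (`stub_backbonePZ`, provable, L-sized; templates: the landed
A1/A2 of `Lines/birth.lean`). The single strict inequality the line needs is `θ < ε`
(`stub_backboneFat`: "the critical backbone is fatter than `3/2`-dimensional in the window's
currency", `D_bb = 2 - η - θ > 3/2 ⟺ θ < 1/2 - η = ε_max`). Numerically `θ ≈ 0.23–0.27`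
(HT-graph / single-cluster dimension `1.735–1.75` on `ℤ³`, Winter–Janke–Schakel PRE 77 (2008) 061108 =
arXiv:0803.2177; worm jobs j013706–j013710 of crux 13885, `D_single = 1.75(3)`) — these bound `θ_bb` from BELOW only (backbone ⊆ odd subgraph ⊆ cluster: `θ_bb ≥ 0.21`); against the
room `ε_max = 1/2 - η ≈ 0.46` there is a factor-two margin IF the rk-backbone is as fat as the odd cluster, but
`θ_bb` itself is unmeasured (a deterministic-ranking backbone may be thinner, as percolation's shortest path
warns) — the strategist's Monte-Carlo of the card's cheapest falsifier decides it. Unlike the pointwise `SingleDouble`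
(`θ = 0`, numerically FALSE, `CoulombImpliesNontrivial/Disproof.lean` §8) and unlike the dead
`partner-backbone-cut` of crux 0636 (weak roughness `D_bb > 1+η` plus a shadow/burstiness stub (B)
predicted false): here ALL the open content is ONE two-sided density estimate for ONE sourced current,
and no shadow / cut two-point bound is needed (the second moment closes with K-chains + WINDOW).

WINDOW is load-bearing twice: it supplies the room `ε` (`stub_backboneFat`, `stub_backbonePZ`) and the
all-scale comparability of the box two-point functions entering `K` (doubling 5508, MMS, top-heavy
bubble 5509 — all landed). `d = 3` enters only through WINDOW (false on `ℤ^d`, `d ≥ 5`) and through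
`θ < ε`; both thinning statements are believed meaningful in every dimension (in `d ≥ 5` the analogue of
WINDOW fails, so no contradiction with triviality there) — this is the structural advantage of crux 5505
over crux 0636: the open stub need not itself carry the `d < 4` input.

Composition `windowForcesU4_of_stubs` (sorry-free): thinning (θ) + fatness (θ < ε, ε admissible) + PZ
⇒ backbones meet with probability `≥ c₀` eventually in `L`, `n` ⇒ (`stub_mergeOfBackbonesMeet`)
`merge ≥ c₀` along the canonical shape ⇒ Aizenman far merging of the lattice Ursell function
(`criticalUrsellFour_le_of_frequently_le_merge`, landed) ⇒ `HasNontrivialU4 S` for every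
non-degenerate pointwise limit (item 4471 `farMergingGivesU4_proof`, landed).

Disproof used: no `Cruxes/WindowForcesU4/Disproof.lean` exists (2026-08-17). Honoured from the sibling
disproofs: 0636 `Disproof.lean` §A `false_without_latticeClause` (every stub is a lattice statement),
§D (`d < 4` enters via WINDOW and `θ < ε`); `CoulombImpliesNontrivial/Disproof.lean` §7(ii)–(iii)
(no graph-uniform SingleDouble — none is posited; "PZ works iff D > 3/2 PROVIDED BOTH moments are taken
at the single-current scale" — exactly the cut made here) and §8 (`θ = 0` false — θ is free here).
`ledger negatives --problem CriticalPhenomena`: none in this sub-problem.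

References: M. Aizenman, Comm. Math. Phys. 86 (1982) §5 Prop. 5.3, §9; M. Aizenman, H. Duminil-Copin,
Ann. of Math. 194 (2021) = arXiv:1912.07973 §4.2, §6.2 (chain rule for backbones), App. A;
M. Aizenman, Geometric analysis of Ising models III, arXiv:2509.02850 §4–5 (Thm 5.1);
H. Duminil-Copin, R. Panis, arXiv:2404.05700 Thm 1.5; F. Winter, W. Janke, A. Schakel, arXiv:0803.2177.
-/

/-!
## Reshape r1 (lead c3, `prover-line-stmt-CriticalPhenomena-5505-c3-0`, 2026-08-17)

The strategist's L-sized stub `stub_backbonePZ` is split at the skeleton level into four registered,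
template-backed stubs, and the old statement is PROVED from them in this file (`backbonePZ`, glue only):
* `stub_thetaBubble` (M) — the θ-weighted top-heavy bubble under WINDOW with room `θ < ε`:
  `Σ_{0 ≠ w ∈ Λ_R} ‖w‖^{-2θ} G(w)² ≤ C_b R^{3-2θ} G(Re₁)²` (template: item 5509 `windowGivesTopHeavyBubble_proof`);
* `stub_backboneCauchySchwarz` (M) — `E[N]² ≤ P[Γ₁ ∩ Γ₂ ≠ ∅]·E[N²]` for `N = #(Γ₁ ∩ Γ₂ ∩ A)` under the
  product law `doubleCurrentMeasure = P^{ab} ⊗ P^{a'b'}`, moments factorised (template: `smc_firstMoment_sq_le` of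
  `Theorems/FKParityRobustnessIndependentStrandsJoinR1SecondMomentCurrents`, clusters ↦ backbones);
* `stub_backboneDensityDictionary` (S–M) — the un-normalised current-sum bounds of `stub_backboneExponent` read as
  bounds on `P^{ab}`-probabilities against `threePointRatio` / `twoStep / boxG` (template: §2 of
  `Theorems/LatticeSDPCertificatesWindowForcesU4MeetSecondMomentBox`, `isingTwoPoint_free_box_eq_toReal_div`);
* `stub_backboneMomentComparison` (L) — the real-analysis heart of Paley–Zygmund at the single-current scale on the
  counting region `Λ_L + 2Le₁` for the canonical shape: `c₀·Σ_{u,v} g₁g₂ ≤ (Σ_u f₁f₂)²` for any densities obeying the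
  two-sided bounds, from WINDOW (pair window, doubling, MMS) and the θ-bubble (template: A2
  `Theorems/LatticeSDPCertificatesWindowForcesU4WindowLatticeMomentRatio`).
Stub count 7 = stubs_max; `stub_backboneExponent`, `stub_backboneFat` (held by the lead), `stub_mergeOfBackbonesMeet`
unchanged. Composition `windowForcesU4_of_stubs` unchanged (consumes `backbonePZ`).
-/

noncomputable section

namespace Summit.CriticalPhenomena.Ising3DConformalLimit.Cruxes.WindowForcesU4.BackboneThinningWindow

open Filter Topology MeasureTheory
open scoped symmDiff ENNReal
open Literature.Probability.LatticeModels Literature.Probability.Percolation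
open Summit.CriticalPhenomena.Ising3DConformalLimit.GapForcesFarMergingSandwich (merge)
open Summit.CriticalPhenomena.Ising3DConformalLimit.EnergyNotSigmaSquaredGapForcesFarMergingSandwich.FarMergingSpinsProof
  (criticalUrsellFour_le_of_frequently_le_merge)
open Summit.CriticalPhenomena.Ising3DConformalLimit.Cruxes.IsingEuclidUpgradeR4NonGaussian.FreeCovarianceDeltaDichotomy
  (boxG threePointRatio twoStep)
open Summit.CriticalPhenomena.Ising3DConformalLimit.LatticeSDPCertificatesWindowForcesU4 (eventually_smul_mem_box)

/-! ## The registered stubs -/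

/-- **Stub 1 — `stub_backboneExponent` (THE BACKBONE HAS A THINNING EXPONENT; open, regularity half,
L–XL).** Under WINDOW there is `θ ≥ 0` such that, eventually in the scale `L` and in the box size `n`,
for some injective bond ranking `rk` of the free box `Λ_n`, the Aizenman backbone `Γ = vis (explore rk m
{b} a)` of the critical current `m` with sources `{a,b}` satisfies, at all MACROSCOPIC sites `u, v`
(distances to `a`, `b` in `[L, 8L]`, `‖a-b‖ ∈ [L, 8L]`, and `‖a‖, ‖b‖ ≤ 8L` so that
everything sits in the bulk of `Λ_n` as `n → ∞`): the one-point LOWER bound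
`P^{ab}[u ∈ Γ] ≥ c L^{-θ} ⟨σ_aσ_u⟩⟨σ_uσ_b⟩/⟨σ_aσ_b⟩` and the two-point UPPER bound
`P^{ab}[u, v ∈ Γ] ≤ C L^{-θ} ‖u-v‖^{-θ} (⟨σ_aσ_u⟩⟨σ_uσ_v⟩⟨σ_vσ_b⟩ + ⟨σ_aσ_v⟩⟨σ_vσ_u⟩⟨σ_uσ_b⟩)/⟨σ_aσ_b⟩`
(un-normalised current-sum form, box two-point functions `Z[·]`, exactly the currency of the landed chain
rule `Current.tsum_backboneVisits_mul_le`, which is the case `θ = 0` of the upper bounds). Two-sided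
with ONE exponent: the backbone has dimension `D_bb = 2 - η - θ` in the quasi-multiplicative sense.
[cite: AizenmanCMP1982, §9 Prop. 9.2] [cite: AizenmanDuminilCopinAnnals2021, §6.2 (6.11)] -/
theorem stub_backboneExponent :
    (∃ ε c : ℝ, 0 < ε ∧ 0 < c ∧ ∀ m n : ℕ, 1 ≤ m → m ≤ n → c * ((n : ℝ) / m) ^ (-((3:ℝ) / 2 - ε)) * criticalTwoPoint 3 (Pi.single 0 (m : ℤ)) ≤ criticalTwoPoint 3 (Pi.single 0 (n : ℤ))) →
      ∃ θ c C : ℝ, 0 ≤ θ ∧ 0 < c ∧ 0 < C ∧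
      (∀ᶠ L : ℕ in atTop, ∀ᶠ n : ℕ in atTop,
        ∃ rk : (freeBoxGraph 3 n).edgeFinset → ℕ, Function.Injective rk ∧
          (∀ a b u : BoxVertex 3 n, ‖(a : Site 3)‖ ≤ 8 * (L : ℝ) → ‖(b : Site 3)‖ ≤ 8 * (L : ℝ) →
            (L : ℝ) ≤ ‖(a : Site 3) - (b : Site 3)‖ → ‖(a : Site 3) - (b : Site 3)‖ ≤ 8 * (L : ℝ) →
            (L : ℝ) ≤ ‖(u : Site 3) - (a : Site 3)‖ → ‖(u : Site 3) - (a : Site 3)‖ ≤ 8 * (L : ℝ) →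
            (L : ℝ) ≤ ‖(u : Site 3) - (b : Site 3)‖ → ‖(u : Site 3) - (b : Site 3)‖ ≤ 8 * (L : ℝ) →
            ENNReal.ofReal (c * (L : ℝ) ^ (-θ)) *
                (ecurrentSum (fun _ : (freeBoxGraph 3 n).edgeFinset => criticalBeta 3) ({a} ∆ {u}) *
                  ecurrentSum (fun _ : (freeBoxGraph 3 n).edgeFinset => criticalBeta 3) ({u} ∆ {b})) ≤
              (∑' m : Current (freeBoxGraph 3 n),
                  (if m.sources = {a} ∆ {b} then m.eweight (fun _ => criticalBeta 3) else 0) *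
                    (if u ∈ (Current.explore rk m {b} a).vis then 1 else 0)) *
                ecurrentSum (fun _ : (freeBoxGraph 3 n).edgeFinset => criticalBeta 3) ∅) ∧
          (∀ a b u v : BoxVertex 3 n, u ≠ v → ‖(a : Site 3)‖ ≤ 8 * (L : ℝ) → ‖(b : Site 3)‖ ≤ 8 * (L : ℝ) →
            (L : ℝ) ≤ ‖(a : Site 3) - (b : Site 3)‖ → ‖(a : Site 3) - (b : Site 3)‖ ≤ 8 * (L : ℝ) →
            (L : ℝ) ≤ ‖(u : Site 3) - (a : Site 3)‖ → ‖(u : Site 3) - (a : Site 3)‖ ≤ 8 * (L : ℝ) →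
            (L : ℝ) ≤ ‖(u : Site 3) - (b : Site 3)‖ → ‖(u : Site 3) - (b : Site 3)‖ ≤ 8 * (L : ℝ) →
            (L : ℝ) ≤ ‖(v : Site 3) - (a : Site 3)‖ → ‖(v : Site 3) - (a : Site 3)‖ ≤ 8 * (L : ℝ) →
            (L : ℝ) ≤ ‖(v : Site 3) - (b : Site 3)‖ → ‖(v : Site 3) - (b : Site 3)‖ ≤ 8 * (L : ℝ) →
            (∑' m : Current (freeBoxGraph 3 n),
                (if m.sources = {a} ∆ {b} then m.eweight (fun _ => criticalBeta 3) else 0) *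
                  (if u ∈ (Current.explore rk m {b} a).vis ∧ v ∈ (Current.explore rk m {b} a).vis then 1 else 0)) *
                ecurrentSum (fun _ : (freeBoxGraph 3 n).edgeFinset => criticalBeta 3) ∅ * ecurrentSum (fun _ : (freeBoxGraph 3 n).edgeFinset => criticalBeta 3) ∅ ≤
              ENNReal.ofReal (C * (L : ℝ) ^ (-θ) * ‖(u : Site 3) - (v : Site 3)‖ ^ (-θ)) *
                (ecurrentSum (fun _ : (freeBoxGraph 3 n).edgeFinset => criticalBeta 3) ({a} ∆ {u}) * ecurrentSum (fun _ : (freeBoxGraph 3 n).edgeFinset => criticalBeta 3) ({u} ∆ {v}) * ecurrentSum (fun _ : (freeBoxGraph 3 n).edgeFinset => criticalBeta 3) ({v} ∆ {b}) +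
                  ecurrentSum (fun _ : (freeBoxGraph 3 n).edgeFinset => criticalBeta 3) ({a} ∆ {v}) * ecurrentSum (fun _ : (freeBoxGraph 3 n).edgeFinset => criticalBeta 3) ({v} ∆ {u}) * ecurrentSum (fun _ : (freeBoxGraph 3 n).edgeFinset => criticalBeta 3) ({u} ∆ {b})))) := by
  sorry

/-- **Stub 2 — `stub_backboneFat` (THE BACKBONE IS FATTER THAN `3/2`-DIMENSIONAL IN THE WINDOW'S CURRENCY;
open, THE HARDEST STUB, XL).** Under WINDOW, any two-sided thinning exponent `θ` of Stub 1 is beaten by an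
ADMISSIBLE window exponent: there are `ε > θ` and `cW > 0` with `cW (n/m)^{-(3/2-ε)} G(m e₁) ≤ G(n e₁)`
for all `1 ≤ m ≤ n`. Equivalently `D_bb > 3/2` with the room measured by the window (`θ < 1/2 - η_eff`);
numerically `θ_bb ≥ 0.21` is known and `θ_bb < 0.46` is the bet (MC submitted). This is the single strict exponent
inequality of the line (a LOWER bound
on the roughness of one sourced critical current, the universal missing ingredient (F) of the 0636 chain,
here in its Paley–Zygmund-closable two-sided form). [cite: AizenmanCMP1982, §9] -/
theorem stub_backboneFat :
    (∃ ε c : ℝ, 0 < ε ∧ 0 < c ∧ ∀ m n : ℕ, 1 ≤ m → m ≤ n → c * ((n : ℝ) / m) ^ (-((3:ℝ) / 2 - ε)) * criticalTwoPoint 3 (Pi.single 0 (m : ℤ)) ≤ criticalTwoPoint 3 (Pi.single 0 (n : ℤ))) →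
      ∀ θ c C : ℝ, 0 ≤ θ → 0 < c → 0 < C →
      (∀ᶠ L : ℕ in atTop, ∀ᶠ n : ℕ in atTop,
        ∃ rk : (freeBoxGraph 3 n).edgeFinset → ℕ, Function.Injective rk ∧
          (∀ a b u : BoxVertex 3 n, ‖(a : Site 3)‖ ≤ 8 * (L : ℝ) → ‖(b : Site 3)‖ ≤ 8 * (L : ℝ) →
            (L : ℝ) ≤ ‖(a : Site 3) - (b : Site 3)‖ → ‖(a : Site 3) - (b : Site 3)‖ ≤ 8 * (L : ℝ) →
            (L : ℝ) ≤ ‖(u : Site 3) - (a : Site 3)‖ → ‖(u : Site 3) - (a : Site 3)‖ ≤ 8 * (L : ℝ) →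
            (L : ℝ) ≤ ‖(u : Site 3) - (b : Site 3)‖ → ‖(u : Site 3) - (b : Site 3)‖ ≤ 8 * (L : ℝ) →
            ENNReal.ofReal (c * (L : ℝ) ^ (-θ)) *
                (ecurrentSum (fun _ : (freeBoxGraph 3 n).edgeFinset => criticalBeta 3) ({a} ∆ {u}) *
                  ecurrentSum (fun _ : (freeBoxGraph 3 n).edgeFinset => criticalBeta 3) ({u} ∆ {b})) ≤
              (∑' m : Current (freeBoxGraph 3 n),
                  (if m.sources = {a} ∆ {b} then m.eweight (fun _ => criticalBeta 3) else 0) *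
                    (if u ∈ (Current.explore rk m {b} a).vis then 1 else 0)) *
                ecurrentSum (fun _ : (freeBoxGraph 3 n).edgeFinset => criticalBeta 3) ∅) ∧
          (∀ a b u v : BoxVertex 3 n, u ≠ v → ‖(a : Site 3)‖ ≤ 8 * (L : ℝ) → ‖(b : Site 3)‖ ≤ 8 * (L : ℝ) →
            (L : ℝ) ≤ ‖(a : Site 3) - (b : Site 3)‖ → ‖(a : Site 3) - (b : Site 3)‖ ≤ 8 * (L : ℝ) →
            (L : ℝ) ≤ ‖(u : Site 3) - (a : Site 3)‖ → ‖(u : Site 3) - (a : Site 3)‖ ≤ 8 * (L : ℝ) →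
            (L : ℝ) ≤ ‖(u : Site 3) - (b : Site 3)‖ → ‖(u : Site 3) - (b : Site 3)‖ ≤ 8 * (L : ℝ) →
            (L : ℝ) ≤ ‖(v : Site 3) - (a : Site 3)‖ → ‖(v : Site 3) - (a : Site 3)‖ ≤ 8 * (L : ℝ) →
            (L : ℝ) ≤ ‖(v : Site 3) - (b : Site 3)‖ → ‖(v : Site 3) - (b : Site 3)‖ ≤ 8 * (L : ℝ) →
            (∑' m : Current (freeBoxGraph 3 n),
                (if m.sources = {a} ∆ {b} then m.eweight (fun _ => criticalBeta 3) else 0) *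
                  (if u ∈ (Current.explore rk m {b} a).vis ∧ v ∈ (Current.explore rk m {b} a).vis then 1 else 0)) *
                ecurrentSum (fun _ : (freeBoxGraph 3 n).edgeFinset => criticalBeta 3) ∅ * ecurrentSum (fun _ : (freeBoxGraph 3 n).edgeFinset => criticalBeta 3) ∅ ≤
              ENNReal.ofReal (C * (L : ℝ) ^ (-θ) * ‖(u : Site 3) - (v : Site 3)‖ ^ (-θ)) *
                (ecurrentSum (fun _ : (freeBoxGraph 3 n).edgeFinset => criticalBeta 3) ({a} ∆ {u}) * ecurrentSum (fun _ : (freeBoxGraph 3 n).edgeFinset => criticalBeta 3) ({u} ∆ {v}) * ecurrentSum (fun _ : (freeBoxGraph 3 n).edgeFinset => criticalBeta 3) ({v} ∆ {b}) +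
                  ecurrentSum (fun _ : (freeBoxGraph 3 n).edgeFinset => criticalBeta 3) ({a} ∆ {v}) * ecurrentSum (fun _ : (freeBoxGraph 3 n).edgeFinset => criticalBeta 3) ({v} ∆ {u}) * ecurrentSum (fun _ : (freeBoxGraph 3 n).edgeFinset => criticalBeta 3) ({u} ∆ {b})))) →
      ∃ ε cW : ℝ, 0 < ε ∧ 0 < cW ∧
        (∀ m n : ℕ, 1 ≤ m → m ≤ n → cW * ((n : ℝ) / m) ^ (-((3:ℝ) / 2 - ε)) * criticalTwoPoint 3 (Pi.single 0 (m : ℤ)) ≤ criticalTwoPoint 3 (Pi.single 0 (n : ℤ))) ∧ θ < ε := by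
  sorry

/-- **Stub P0 — `stub_thetaBubble` (θ-WEIGHTED TOP-HEAVY BUBBLE; provable now, M).** Under an admissible
window `(ε, cW)` and `0 ≤ θ < ε`: `Σ_{0 ≠ w ∈ Λ_R} ‖w‖^{-2θ} G(w)² ≤ C_b R^{3-2θ} G(Re₁)²` for all `R ≥ 1`
(MMS `G(w) ≤ G(‖w‖_∞ e₁)`, WINDOW between the scales `‖w‖_∞` and `R`, shells `|∂Λ_k| ≤ 24k²+2`, and
`Σ_{k≤R} k^{-1+2(ε-θ)} ≤ (1 + 1/(2(ε-θ))) R^{2(ε-θ)}`); the case `θ = 0` is item 5509.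
[cite: AizenmanDuminilCopinAnnals2021, §4.2 (bubble condition)] -/
theorem stub_thetaBubble :
    ∀ θ ε cW : ℝ, 0 ≤ θ → θ < ε → 0 < cW →
      (∀ m n : ℕ, 1 ≤ m → m ≤ n → cW * ((n : ℝ) / m) ^ (-((3:ℝ) / 2 - ε)) * criticalTwoPoint 3 (Pi.single 0 (m : ℤ)) ≤ criticalTwoPoint 3 (Pi.single 0 (n : ℤ))) →
      ∃ Cb : ℝ, 0 < Cb ∧ ∀ R : ℕ, 1 ≤ R →
        ∑ w ∈ (box 3 R).erase 0, ‖w‖ ^ (-(2 * θ)) * criticalTwoPoint 3 w ^ 2 ≤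
          Cb * (R : ℝ) ^ (3 - 2 * θ) * criticalTwoPoint 3 (Pi.single 0 (R : ℤ)) ^ 2 :=
  -- LANDED (wave 1, lead c3): Summit.CriticalPhenomena.Ising3DConformalLimit.LatticeSDPCertificatesWindowForcesU4.ThetaBubbleProof.stub_thetaBubble
  Summit.CriticalPhenomena.Ising3DConformalLimit.LatticeSDPCertificatesWindowForcesU4.ThetaBubbleProof.stub_thetaBubble

/-- **Stub P1 — `stub_backboneCauchySchwarz` (SECOND-MOMENT INEQUALITY FOR BACKBONE INTERSECTIONS; provable
now, M).** In the free box, for the product law `P^{ab} ⊗ P^{a'b'} = doubleCurrentMeasure` of two independent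
single sourced critical currents and any finite set `A` of box vertices, with `Γ₁ = vis (explore rk n₁ {b} a)`,
`Γ₂ = vis (explore rk n₂ {b'} a')` and `N = #(Γ₁ ∩ Γ₂ ∩ A)`: `E[N]² ≤ P[Γ₁ ∩ Γ₂ ≠ ∅] · E[N²]`, both moments
factorised over the two independent currents (Cauchy–Schwarz `E[N]² ≤ P[N ≠ 0] E[N²]` and `{N ≠ 0} ⊆
{Γ₁ ∩ Γ₂ ≠ ∅}`). [cite: AizenmanDuminilCopinAnnals2021, §4.2, proof of Lemma 4.4] -/
theorem stub_backboneCauchySchwarz :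
    ∀ (n : ℕ) (rk : (freeBoxGraph 3 n).edgeFinset → ℕ) (a b a' b' : BoxVertex 3 n) (A : Finset (BoxVertex 3 n)),
      (∑ u ∈ A, (currentLaw (freeBoxGraph 3 n) (criticalBeta 3) ({a} ∆ {b})).real {m | u ∈ (Current.explore rk m {b} a).vis} *
          (currentLaw (freeBoxGraph 3 n) (criticalBeta 3) ({a'} ∆ {b'})).real {m | u ∈ (Current.explore rk m {b'} a').vis}) ^ 2 ≤
        (doubleCurrentMeasure (freeBoxGraph 3 n) (criticalBeta 3) ({a} ∆ {b}) ({a'} ∆ {b'})).real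
            {p | ((Current.explore rk p.1 {b} a).vis ∩ (Current.explore rk p.2 {b'} a').vis).Nonempty} *
          ∑ u ∈ A, ∑ v ∈ A,
            (currentLaw (freeBoxGraph 3 n) (criticalBeta 3) ({a} ∆ {b})).real
                {m | u ∈ (Current.explore rk m {b} a).vis ∧ v ∈ (Current.explore rk m {b} a).vis} *
              (currentLaw (freeBoxGraph 3 n) (criticalBeta 3) ({a'} ∆ {b'})).real
                {m | u ∈ (Current.explore rk m {b'} a').vis ∧ v ∈ (Current.explore rk m {b'} a').vis} := by
  -- LANDED (wave 1, lead c3): Summit.CriticalPhenomena.Ising3DConformalLimit.LatticeSDPCertificatesWindowForcesU4.BackboneCauchySchwarzProof.stub_backboneCauchySchwarz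
  -- (stated there under `open scoped Classical`; `convert` bridges the `Decidable` instances)
  intro n rk a b a' b' A
  convert Summit.CriticalPhenomena.Ising3DConformalLimit.LatticeSDPCertificatesWindowForcesU4.BackboneCauchySchwarzProof.stub_backboneCauchySchwarz n rk a b a' b' A using 0

/-- **Stub P2 — `stub_backboneDensityDictionary` (CURRENT SUMS ↦ PROBABILITIES; provable now, S–M).** For box
vertices `a ≠ b`, `u`, `v` of `Λ_n` and `κ ≥ 0`: the un-normalised one-point LOWER bound of `stub_backboneExponent`
(`κ·Z[au]Z[ub] ≤ (Σ_{∂m=ab} w(m)𝟙[u ∈ Γ])·Z[∅]`) gives `κ·G_n(a,u)G_n(u,b)/G_n(a,b) ≤ P^{ab}_{Λ_n}[u ∈ Γ]`, and the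
un-normalised two-point UPPER bound (`(Σ w 𝟙[u,v ∈ Γ])·Z[∅]² ≤ κ·(Z[au]Z[uv]Z[vb] + Z[av]Z[vu]Z[ub])`) gives
`P^{ab}_{Λ_n}[u,v ∈ Γ] ≤ κ·twoStep_n(a,b,u,v)/G_n(a,b)` (`P^{ab}{m} = w(m)/Z[ab]`, `G_n(x,y) = Z[xy]/Z[∅]`,
`isingTwoPoint_free_box_eq_toReal_div`; degenerate normalisers by `x/0 = 0`). [folklore] -/
theorem stub_backboneDensityDictionary :
    ∀ (n : ℕ) (rk : (freeBoxGraph 3 n).edgeFinset → ℕ) (a b u v : BoxVertex 3 n) (κ : ℝ), 0 ≤ κ →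
      (a : Site 3) ∈ box 3 n → (b : Site 3) ∈ box 3 n → (u : Site 3) ∈ box 3 n → (v : Site 3) ∈ box 3 n → a ≠ b →
      (ENNReal.ofReal κ *
            (ecurrentSum (fun _ : (freeBoxGraph 3 n).edgeFinset => criticalBeta 3) ({a} ∆ {u}) *
              ecurrentSum (fun _ : (freeBoxGraph 3 n).edgeFinset => criticalBeta 3) ({u} ∆ {b})) ≤
          (∑' m : Current (freeBoxGraph 3 n),
              (if m.sources = {a} ∆ {b} then m.eweight (fun _ => criticalBeta 3) else 0) *
                (if u ∈ (Current.explore rk m {b} a).vis then 1 else 0)) *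
            ecurrentSum (fun _ : (freeBoxGraph 3 n).edgeFinset => criticalBeta 3) ∅ →
        κ * threePointRatio n (a : Site 3) (b : Site 3) (u : Site 3) ≤
          (currentLaw (freeBoxGraph 3 n) (criticalBeta 3) ({a} ∆ {b})).real {m | u ∈ (Current.explore rk m {b} a).vis}) ∧
      ((∑' m : Current (freeBoxGraph 3 n),
            (if m.sources = {a} ∆ {b} then m.eweight (fun _ => criticalBeta 3) else 0) *
              (if u ∈ (Current.explore rk m {b} a).vis ∧ v ∈ (Current.explore rk m {b} a).vis then 1 else 0)) *
            ecurrentSum (fun _ : (freeBoxGraph 3 n).edgeFinset => criticalBeta 3) ∅ * ecurrentSum (fun _ : (freeBoxGraph 3 n).edgeFinset => criticalBeta 3) ∅ ≤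
          ENNReal.ofReal κ *
            (ecurrentSum (fun _ : (freeBoxGraph 3 n).edgeFinset => criticalBeta 3) ({a} ∆ {u}) * ecurrentSum (fun _ : (freeBoxGraph 3 n).edgeFinset => criticalBeta 3) ({u} ∆ {v}) * ecurrentSum (fun _ : (freeBoxGraph 3 n).edgeFinset => criticalBeta 3) ({v} ∆ {b}) +
              ecurrentSum (fun _ : (freeBoxGraph 3 n).edgeFinset => criticalBeta 3) ({a} ∆ {v}) * ecurrentSum (fun _ : (freeBoxGraph 3 n).edgeFinset => criticalBeta 3) ({v} ∆ {u}) * ecurrentSum (fun _ : (freeBoxGraph 3 n).edgeFinset => criticalBeta 3) ({u} ∆ {b})) →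
        (currentLaw (freeBoxGraph 3 n) (criticalBeta 3) ({a} ∆ {b})).real
            {m | u ∈ (Current.explore rk m {b} a).vis ∧ v ∈ (Current.explore rk m {b} a).vis} ≤
          κ * twoStep n (a : Site 3) (b : Site 3) (u : Site 3) (v : Site 3) / boxG n (a : Site 3) (b : Site 3)) := by
  -- LANDED (wave 1, lead c3): Summit.CriticalPhenomena.Ising3DConformalLimit.LatticeSDPCertificatesWindowForcesU4.BackboneDensityDictionaryProof.stub_backboneDensityDictionary
  have h := Summit.CriticalPhenomena.Ising3DConformalLimit.LatticeSDPCertificatesWindowForcesU4.BackboneDensityDictionaryProof.stub_backboneDensityDictionary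
  convert h using 0

/-- **Stub P3 — `stub_backboneMomentComparison` (MOMENT COMPARISON ON THE COUNTING REGION; provable now, L).**
Under an admissible window `(ε, cW)` with room `θ < ε` and the θ-bubble with constant `C_b`: there is `c₀ > 0` such
that, eventually in `L` and then in `n`, for the canonical sources `a = 0`, `b = 4Le₁`, `a' = 2Le₁+3Le₂`,
`b' = 2Le₁-3Le₂` and ANY densities `f₁ f₂` (one-point) and `g₁ g₂` (two-point) on the box obeying, on the
counting region `A = Λ_L + 2Le₁` (box vertices `u` with `u - 2Le₁ ∈ Λ_L`), the one-point lower bounds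
`fᵢ(u) ≥ c L^{-θ} threePointRatio`, the diagonal bounds `0 ≤ gᵢ(u,u) ≤ fᵢ(u)` and the off-diagonal upper bounds
`0 ≤ gᵢ(u,v) ≤ C L^{-θ} ‖u-v‖^{-θ} twoStep/boxG`: `c₀ · Σ_{u,v ∈ A} g₁g₂ ≤ (Σ_{u ∈ A} f₁f₂)²` and
`Σ_{u∈A} f₁f₂ > 0`. Proof (A2 template): box two-point functions → `G` at the finitely many pairs (eventually
in `n`), pair window `ℓ G(Le₁) ≤ G(x) ≤ G(Le₁)/ℓ` for `L ≤ ‖x‖_∞ ≤ 16L` (doubling 5508 + MMS), so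
`Σ_u f₁f₂ ≥ c²L^{-2θ}|A|ℓ⁴G(Le₁)²/4 ≥ c' L^{2(ε-θ)} ≥ c'` (WINDOW at `m = 1`), while the off-diagonal sum is
`≤ C'L^{-2θ} G(Le₁)² |A| Σ_{0≠|w|≤2L} ‖w‖^{-2θ} G(w)² ≤ C'' L^{6-4θ} G(Le₁)⁴` by the θ-bubble at `R = 2L` and
doubling. [cite: AizenmanDuminilCopinAnnals2021, §4.2 Lemma 4.4] -/
theorem stub_backboneMomentComparison :
    ∀ θ c C ε cW Cb : ℝ, 0 ≤ θ → 0 < c → 0 < C → 0 < ε → 0 < cW → θ < ε → 0 < Cb →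
      (∀ m n : ℕ, 1 ≤ m → m ≤ n → cW * ((n : ℝ) / m) ^ (-((3:ℝ) / 2 - ε)) * criticalTwoPoint 3 (Pi.single 0 (m : ℤ)) ≤ criticalTwoPoint 3 (Pi.single 0 (n : ℤ))) →
      (∀ R : ℕ, 1 ≤ R →
        ∑ w ∈ (box 3 R).erase 0, ‖w‖ ^ (-(2 * θ)) * criticalTwoPoint 3 w ^ 2 ≤
          Cb * (R : ℝ) ^ (3 - 2 * θ) * criticalTwoPoint 3 (Pi.single 0 (R : ℤ)) ^ 2) →
      ∃ c₀ : ℝ, 0 < c₀ ∧ ∀ᶠ L : ℕ in atTop, ∀ᶠ n : ℕ in atTop,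
        ∀ a b a' b' : BoxVertex 3 n,
          (a : Site 3) = (L : ℤ) • (![0, (4 : ℤ) • Pi.single 0 1, (2 : ℤ) • Pi.single 0 1 + (3 : ℤ) • Pi.single 1 1, (2 : ℤ) • Pi.single 0 1 - (3 : ℤ) • Pi.single 1 1] : Fin 4 → Site 3) 0 →
          (b : Site 3) = (L : ℤ) • (![0, (4 : ℤ) • Pi.single 0 1, (2 : ℤ) • Pi.single 0 1 + (3 : ℤ) • Pi.single 1 1, (2 : ℤ) • Pi.single 0 1 - (3 : ℤ) • Pi.single 1 1] : Fin 4 → Site 3) 1 →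
          (a' : Site 3) = (L : ℤ) • (![0, (4 : ℤ) • Pi.single 0 1, (2 : ℤ) • Pi.single 0 1 + (3 : ℤ) • Pi.single 1 1, (2 : ℤ) • Pi.single 0 1 - (3 : ℤ) • Pi.single 1 1] : Fin 4 → Site 3) 2 →
          (b' : Site 3) = (L : ℤ) • (![0, (4 : ℤ) • Pi.single 0 1, (2 : ℤ) • Pi.single 0 1 + (3 : ℤ) • Pi.single 1 1, (2 : ℤ) • Pi.single 0 1 - (3 : ℤ) • Pi.single 1 1] : Fin 4 → Site 3) 3 →
          ∀ (f₁ f₂ : BoxVertex 3 n → ℝ) (g₁ g₂ : BoxVertex 3 n → BoxVertex 3 n → ℝ),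
            (∀ u : BoxVertex 3 n, ((u : Site 3) - (2 * (L : ℤ)) • (Pi.single 0 1 : Site 3)) ∈ box 3 L →
              c * (L : ℝ) ^ (-θ) * threePointRatio n (a : Site 3) (b : Site 3) (u : Site 3) ≤ f₁ u ∧
              c * (L : ℝ) ^ (-θ) * threePointRatio n (a' : Site 3) (b' : Site 3) (u : Site 3) ≤ f₂ u ∧
              0 ≤ g₁ u u ∧ g₁ u u ≤ f₁ u ∧ 0 ≤ g₂ u u ∧ g₂ u u ≤ f₂ u) →
            (∀ u v : BoxVertex 3 n, u ≠ v → ((u : Site 3) - (2 * (L : ℤ)) • (Pi.single 0 1 : Site 3)) ∈ box 3 L → ((v : Site 3) - (2 * (L : ℤ)) • (Pi.single 0 1 : Site 3)) ∈ box 3 L →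
              0 ≤ g₁ u v ∧
              g₁ u v ≤ C * (L : ℝ) ^ (-θ) * ‖(u : Site 3) - (v : Site 3)‖ ^ (-θ) *
                twoStep n (a : Site 3) (b : Site 3) (u : Site 3) (v : Site 3) / boxG n (a : Site 3) (b : Site 3) ∧
              0 ≤ g₂ u v ∧
              g₂ u v ≤ C * (L : ℝ) ^ (-θ) * ‖(u : Site 3) - (v : Site 3)‖ ^ (-θ) *
                twoStep n (a' : Site 3) (b' : Site 3) (u : Site 3) (v : Site 3) / boxG n (a' : Site 3) (b' : Site 3)) →
            c₀ * ∑ u ∈ Finset.univ.filter (fun u : BoxVertex 3 n => ((u : Site 3) - (2 * (L : ℤ)) • (Pi.single 0 1 : Site 3)) ∈ box 3 L),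
                ∑ v ∈ Finset.univ.filter (fun u : BoxVertex 3 n => ((u : Site 3) - (2 * (L : ℤ)) • (Pi.single 0 1 : Site 3)) ∈ box 3 L), g₁ u v * g₂ u v ≤
              (∑ u ∈ Finset.univ.filter (fun u : BoxVertex 3 n => ((u : Site 3) - (2 * (L : ℤ)) • (Pi.single 0 1 : Site 3)) ∈ box 3 L), f₁ u * f₂ u) ^ 2 ∧
            0 < ∑ u ∈ Finset.univ.filter (fun u : BoxVertex 3 n => ((u : Site 3) - (2 * (L : ℤ)) • (Pi.single 0 1 : Site 3)) ∈ box 3 L), f₁ u * f₂ u :=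
  -- LANDED (wave 1, lead c3): Summit.CriticalPhenomena.Ising3DConformalLimit.LatticeSDPCertificatesWindowForcesU4.BackboneMomentComparisonProof.stub_backboneMomentComparison
  Summit.CriticalPhenomena.Ising3DConformalLimit.LatticeSDPCertificatesWindowForcesU4.BackboneMomentComparisonProof.stub_backboneMomentComparison

/-- **Stub 4 — `stub_mergeOfBackbonesMeet` (BACKBONE INTERSECTION FORCES MERGING; provable now, M).** For
the pair law `P^{ab}⊗P^{a'b'}_{Λ_n}` (`doubleCurrentMeasure`), if the backbone of `n₁` from `a` (target
`b`) and the backbone of `n₂` from `a'` (target `b'`) share a vertex then `a' ↔ a` in the trace of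
`n₁ + n₂` (visited sites are joined to the start by traversed odd — hence open — bonds; traces add), so
the intersection probability is at most `merge n (L•y)` (`sourcedDoubleCurrentLaw` = push-forward of
`doubleCurrentMeasure` under `sourcedTrace`, `Measure.le_map_apply`; `boxSources` of the dilated pair =
`{a} ∆ {b}`). [cite: AizenmanDuminilCopinAnnals2021, eq. (3.11)] -/
theorem stub_mergeOfBackbonesMeet :
    ∀ y : Fin 4 → Site 3, Function.Injective y → ∀ (L n : ℕ)
      (rk : (freeBoxGraph 3 n).edgeFinset → ℕ) (a b a' b' : BoxVertex 3 n),
      (a : Site 3) = (L : ℤ) • y 0 → (b : Site 3) = (L : ℤ) • y 1 →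
      (a' : Site 3) = (L : ℤ) • y 2 → (b' : Site 3) = (L : ℤ) • y 3 → 1 ≤ L →
      (doubleCurrentMeasure (freeBoxGraph 3 n) (criticalBeta 3) ({a} ∆ {b}) ({a'} ∆ {b'})).real
          {p | ((Current.explore rk p.1 {b} a).vis ∩ (Current.explore rk p.2 {b'} a').vis).Nonempty} ≤
        merge n (fun i => (L : ℤ) • y i) :=
  -- LANDED (wave 1, lead c3): Summit.CriticalPhenomena.Ising3DConformalLimit.LatticeSDPCertificatesWindowForcesU4.MergeOfBackbonesMeetProof.stub_mergeOfBackbonesMeet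
  Summit.CriticalPhenomena.Ising3DConformalLimit.LatticeSDPCertificatesWindowForcesU4.MergeOfBackbonesMeetProof.stub_mergeOfBackbonesMeet

/-! ## Glue of reshape r1: the strategist's `stub_backbonePZ` from P0–P3 (sorry-free) -/

section Glue

/-- The canonical shape. [folklore] -/
private abbrev Y : Fin 4 → Site 3 := (![0, (4 : ℤ) • Pi.single 0 1, (2 : ℤ) • Pi.single 0 1 + (3 : ℤ) • Pi.single 1 1, (2 : ℤ) • Pi.single 0 1 - (3 : ℤ) • Pi.single 1 1] : Fin 4 → Site 3)

/-- Coordinates of the canonical shape. [folklore] -/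
private theorem Y_apply (L : ℕ) :
    ((L : ℤ) • Y 0 = 0) ∧
    (∀ i, ((L : ℤ) • Y 1) i = if i = 0 then 4 * (L : ℤ) else 0) ∧
    (∀ i, ((L : ℤ) • Y 2) i = if i = 0 then 2 * (L : ℤ) else if i = 1 then 3 * (L : ℤ) else 0) ∧
    (∀ i, ((L : ℤ) • Y 3) i = if i = 0 then 2 * (L : ℤ) else if i = 1 then -(3 * (L : ℤ)) else 0) := by
  refine ⟨?_, ?_, ?_, ?_⟩
  · simp [Y]
  all_goals intro i; fin_cases i <;> simp [Y] <;> ring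

/-- Sup-norm bounds from coordinate bounds. [folklore] -/
private theorem norm_le_of_coord {x : Site 3} {M : ℕ} (h : ∀ i, (x i).natAbs ≤ M) : ‖x‖ ≤ (M : ℝ) := by
  rw [Site.norm_eq_supNorm]
  exact_mod_cast Site.supNorm_le_iff.2 h

/-- Sup-norm lower bound from one coordinate. [folklore] -/
private theorem le_norm_of_coord {x : Site 3} {M : ℕ} (i : Fin 3) (h : M ≤ (x i).natAbs) : (M : ℝ) ≤ ‖x‖ := by
  rw [Site.norm_eq_supNorm]
  exact_mod_cast h.trans (Site.natAbs_le_supNorm x i)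

/-- Geometry of the counting region `Λ_L + 2Le₁` against the four canonical sources: all eight distances lie in
`[L, 8L]`, and the region lies in `Λ_{3L}`. [folklore] -/
private theorem region_geometry {L : ℕ} {u : Site 3}
    (hu : u - (2 * (L : ℤ)) • (Pi.single 0 1 : Site 3) ∈ box 3 L) :
    ((L : ℝ) ≤ ‖u - (L : ℤ) • Y 0‖ ∧ ‖u - (L : ℤ) • Y 0‖ ≤ 8 * (L : ℝ)) ∧
    ((L : ℝ) ≤ ‖u - (L : ℤ) • Y 1‖ ∧ ‖u - (L : ℤ) • Y 1‖ ≤ 8 * (L : ℝ)) ∧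
    ((L : ℝ) ≤ ‖u - (L : ℤ) • Y 2‖ ∧ ‖u - (L : ℤ) • Y 2‖ ≤ 8 * (L : ℝ)) ∧
    ((L : ℝ) ≤ ‖u - (L : ℤ) • Y 3‖ ∧ ‖u - (L : ℤ) • Y 3‖ ≤ 8 * (L : ℝ)) ∧
    u ∈ box 3 (3 * L) := by
  obtain ⟨h0, h1, h2, h3⟩ := Y_apply L
  rw [mem_box] at hu
  have hu0 := hu 0
  have hu1 := hu 1
  have hu2 := hu 2
  simp only [Pi.sub_apply, Pi.smul_apply, Pi.single_apply, smul_eq_mul] at hu0 hu1 hu2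
  norm_num at hu0 hu1 hu2
  have e8 : (8 : ℝ) * L = ((8 * L : ℕ) : ℝ) := by push_cast; ring
  refine ⟨⟨?_, ?_⟩, ⟨?_, ?_⟩, ⟨?_, ?_⟩, ⟨?_, ?_⟩, ?_⟩
  · refine le_norm_of_coord 0 ?_; rw [h0, sub_zero]; omega
  · rw [e8, h0, sub_zero]; refine norm_le_of_coord fun j => ?_; fin_cases j <;> simp <;> omega
  · refine le_norm_of_coord 0 ?_; rw [Pi.sub_apply, h1 0]; simp; omega
  · rw [e8]; refine norm_le_of_coord fun j => ?_; rw [Pi.sub_apply, h1 j]; fin_cases j <;> simp <;> omega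
  · refine le_norm_of_coord 1 ?_; rw [Pi.sub_apply, h2 1]; simp; omega
  · rw [e8]; refine norm_le_of_coord fun j => ?_; rw [Pi.sub_apply, h2 j]; fin_cases j <;> simp <;> omega
  · refine le_norm_of_coord 1 ?_; rw [Pi.sub_apply, h3 1]; simp; omega
  · rw [e8]; refine norm_le_of_coord fun j => ?_; rw [Pi.sub_apply, h3 j]; fin_cases j <;> simp <;> omega
  · rw [mem_box]; intro j; fin_cases j <;> simp <;> omega

/-- Geometry of the four canonical sources: norms `≤ 8L`, pair distances in `[L, 8L]`, all in `Λ_{4L}`, and the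
two sources of each pair are distinct once `L ≥ 1`. [folklore] -/
private theorem source_geometry {L : ℕ} (hL : 1 ≤ L) :
    (‖(L : ℤ) • Y 0‖ ≤ 8 * (L : ℝ) ∧ ‖(L : ℤ) • Y 1‖ ≤ 8 * (L : ℝ) ∧
      ‖(L : ℤ) • Y 2‖ ≤ 8 * (L : ℝ) ∧ ‖(L : ℤ) • Y 3‖ ≤ 8 * (L : ℝ)) ∧
    ((L : ℝ) ≤ ‖(L : ℤ) • Y 0 - (L : ℤ) • Y 1‖ ∧ ‖(L : ℤ) • Y 0 - (L : ℤ) • Y 1‖ ≤ 8 * (L : ℝ)) ∧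
    ((L : ℝ) ≤ ‖(L : ℤ) • Y 2 - (L : ℤ) • Y 3‖ ∧ ‖(L : ℤ) • Y 2 - (L : ℤ) • Y 3‖ ≤ 8 * (L : ℝ)) ∧
    ((L : ℤ) • Y 0 ∈ box 3 (4 * L) ∧ (L : ℤ) • Y 1 ∈ box 3 (4 * L) ∧
      (L : ℤ) • Y 2 ∈ box 3 (4 * L) ∧ (L : ℤ) • Y 3 ∈ box 3 (4 * L)) ∧
    (L : ℤ) • Y 0 ≠ (L : ℤ) • Y 1 ∧ (L : ℤ) • Y 2 ≠ (L : ℤ) • Y 3 := by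
  obtain ⟨h0, h1, h2, h3⟩ := Y_apply L
  have e8 : (8 : ℝ) * L = ((8 * L : ℕ) : ℝ) := by push_cast; ring
  refine ⟨⟨?_, ?_, ?_, ?_⟩, ⟨?_, ?_⟩, ⟨?_, ?_⟩, ⟨?_, ?_, ?_, ?_⟩, ?_, ?_⟩
  · rw [h0, norm_zero]; positivity
  · rw [e8]; refine norm_le_of_coord fun j => ?_; rw [h1 j]; fin_cases j <;> simp
    omega
  · rw [e8]; refine norm_le_of_coord fun j => ?_; rw [h2 j]; fin_cases j <;> simp <;> omega
  · rw [e8]; refine norm_le_of_coord fun j => ?_; rw [h3 j]; fin_cases j <;> simp <;> omega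
  · refine le_norm_of_coord 0 ?_; rw [Pi.sub_apply, h0, h1 0]; simp; omega
  · rw [e8]; refine norm_le_of_coord fun j => ?_; rw [Pi.sub_apply, h0, h1 j]; fin_cases j <;> simp
    omega
  · refine le_norm_of_coord 1 ?_; rw [Pi.sub_apply, h2 1, h3 1]; simp; omega
  · rw [e8]; refine norm_le_of_coord fun j => ?_; rw [Pi.sub_apply, h2 j, h3 j]; fin_cases j <;> simp
    omega
  · rw [h0, mem_box]; intro j; simp
  · rw [mem_box]; intro j; rw [h1 j]; fin_cases j <;> simp
  · rw [mem_box]; intro j; rw [h2 j]; fin_cases j <;> simp <;> omega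
  · rw [mem_box]; intro j; rw [h3 j]; fin_cases j <;> simp <;> omega
  · intro h; have := congr_fun h 0; rw [h0, Pi.zero_apply, h1 0] at this; simp at this; omega
  · intro h; have := congr_fun h 1; rw [h2 1, h3 1] at this; simp at this; omega

/-- **The strategist's `stub_backbonePZ` (PALEY–ZYGMUND AT THE SINGLE-CURRENT SCALE), now a theorem of the four
registered stubs P0–P3** (reshape r1): θ-bubble (P0) + moment comparison on the counting region (P3) applied to
the backbone densities of the two independent currents, whose bounds are the hypotheses read through the
dictionary (P2), and Cauchy–Schwarz (P1). [cite: AizenmanDuminilCopinAnnals2021, §4.2 Lemma 4.4] -/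
theorem backbonePZ :
    ∀ θ c C ε cW : ℝ, 0 ≤ θ → 0 < c → 0 < C → 0 < ε → 0 < cW → θ < ε →
      (∀ m n : ℕ, 1 ≤ m → m ≤ n → cW * ((n : ℝ) / m) ^ (-((3:ℝ) / 2 - ε)) * criticalTwoPoint 3 (Pi.single 0 (m : ℤ)) ≤ criticalTwoPoint 3 (Pi.single 0 (n : ℤ))) →
      (∀ᶠ L : ℕ in atTop, ∀ᶠ n : ℕ in atTop,
        ∃ rk : (freeBoxGraph 3 n).edgeFinset → ℕ, Function.Injective rk ∧
          (∀ a b u : BoxVertex 3 n, ‖(a : Site 3)‖ ≤ 8 * (L : ℝ) → ‖(b : Site 3)‖ ≤ 8 * (L : ℝ) →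
            (L : ℝ) ≤ ‖(a : Site 3) - (b : Site 3)‖ → ‖(a : Site 3) - (b : Site 3)‖ ≤ 8 * (L : ℝ) →
            (L : ℝ) ≤ ‖(u : Site 3) - (a : Site 3)‖ → ‖(u : Site 3) - (a : Site 3)‖ ≤ 8 * (L : ℝ) →
            (L : ℝ) ≤ ‖(u : Site 3) - (b : Site 3)‖ → ‖(u : Site 3) - (b : Site 3)‖ ≤ 8 * (L : ℝ) →
            ENNReal.ofReal (c * (L : ℝ) ^ (-θ)) *
                (ecurrentSum (fun _ : (freeBoxGraph 3 n).edgeFinset => criticalBeta 3) ({a} ∆ {u}) *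
                  ecurrentSum (fun _ : (freeBoxGraph 3 n).edgeFinset => criticalBeta 3) ({u} ∆ {b})) ≤
              (∑' m : Current (freeBoxGraph 3 n),
                  (if m.sources = {a} ∆ {b} then m.eweight (fun _ => criticalBeta 3) else 0) *
                    (if u ∈ (Current.explore rk m {b} a).vis then 1 else 0)) *
                ecurrentSum (fun _ : (freeBoxGraph 3 n).edgeFinset => criticalBeta 3) ∅) ∧
          (∀ a b u v : BoxVertex 3 n, u ≠ v → ‖(a : Site 3)‖ ≤ 8 * (L : ℝ) → ‖(b : Site 3)‖ ≤ 8 * (L : ℝ) →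
            (L : ℝ) ≤ ‖(a : Site 3) - (b : Site 3)‖ → ‖(a : Site 3) - (b : Site 3)‖ ≤ 8 * (L : ℝ) →
            (L : ℝ) ≤ ‖(u : Site 3) - (a : Site 3)‖ → ‖(u : Site 3) - (a : Site 3)‖ ≤ 8 * (L : ℝ) →
            (L : ℝ) ≤ ‖(u : Site 3) - (b : Site 3)‖ → ‖(u : Site 3) - (b : Site 3)‖ ≤ 8 * (L : ℝ) →
            (L : ℝ) ≤ ‖(v : Site 3) - (a : Site 3)‖ → ‖(v : Site 3) - (a : Site 3)‖ ≤ 8 * (L : ℝ) →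
            (L : ℝ) ≤ ‖(v : Site 3) - (b : Site 3)‖ → ‖(v : Site 3) - (b : Site 3)‖ ≤ 8 * (L : ℝ) →
            (∑' m : Current (freeBoxGraph 3 n),
                (if m.sources = {a} ∆ {b} then m.eweight (fun _ => criticalBeta 3) else 0) *
                  (if u ∈ (Current.explore rk m {b} a).vis ∧ v ∈ (Current.explore rk m {b} a).vis then 1 else 0)) *
                ecurrentSum (fun _ : (freeBoxGraph 3 n).edgeFinset => criticalBeta 3) ∅ * ecurrentSum (fun _ : (freeBoxGraph 3 n).edgeFinset => criticalBeta 3) ∅ ≤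
              ENNReal.ofReal (C * (L : ℝ) ^ (-θ) * ‖(u : Site 3) - (v : Site 3)‖ ^ (-θ)) *
                (ecurrentSum (fun _ : (freeBoxGraph 3 n).edgeFinset => criticalBeta 3) ({a} ∆ {u}) * ecurrentSum (fun _ : (freeBoxGraph 3 n).edgeFinset => criticalBeta 3) ({u} ∆ {v}) * ecurrentSum (fun _ : (freeBoxGraph 3 n).edgeFinset => criticalBeta 3) ({v} ∆ {b}) +
                  ecurrentSum (fun _ : (freeBoxGraph 3 n).edgeFinset => criticalBeta 3) ({a} ∆ {v}) * ecurrentSum (fun _ : (freeBoxGraph 3 n).edgeFinset => criticalBeta 3) ({v} ∆ {u}) * ecurrentSum (fun _ : (freeBoxGraph 3 n).edgeFinset => criticalBeta 3) ({u} ∆ {b})))) →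
      ∃ c₀ : ℝ, 0 < c₀ ∧ ∀ᶠ L : ℕ in atTop, ∀ᶠ n : ℕ in atTop,
        ∃ rk : (freeBoxGraph 3 n).edgeFinset → ℕ, Function.Injective rk ∧
          ∃ a b a' b' : BoxVertex 3 n,
            (a : Site 3) = (L : ℤ) • (![0, (4 : ℤ) • Pi.single 0 1, (2 : ℤ) • Pi.single 0 1 + (3 : ℤ) • Pi.single 1 1, (2 : ℤ) • Pi.single 0 1 - (3 : ℤ) • Pi.single 1 1] : Fin 4 → Site 3) 0 ∧
            (b : Site 3) = (L : ℤ) • (![0, (4 : ℤ) • Pi.single 0 1, (2 : ℤ) • Pi.single 0 1 + (3 : ℤ) • Pi.single 1 1, (2 : ℤ) • Pi.single 0 1 - (3 : ℤ) • Pi.single 1 1] : Fin 4 → Site 3) 1 ∧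
            (a' : Site 3) = (L : ℤ) • (![0, (4 : ℤ) • Pi.single 0 1, (2 : ℤ) • Pi.single 0 1 + (3 : ℤ) • Pi.single 1 1, (2 : ℤ) • Pi.single 0 1 - (3 : ℤ) • Pi.single 1 1] : Fin 4 → Site 3) 2 ∧
            (b' : Site 3) = (L : ℤ) • (![0, (4 : ℤ) • Pi.single 0 1, (2 : ℤ) • Pi.single 0 1 + (3 : ℤ) • Pi.single 1 1, (2 : ℤ) • Pi.single 0 1 - (3 : ℤ) • Pi.single 1 1] : Fin 4 → Site 3) 3 ∧
            c₀ ≤ (doubleCurrentMeasure (freeBoxGraph 3 n) (criticalBeta 3) ({a} ∆ {b}) ({a'} ∆ {b'})).real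
              {p | ((Current.explore rk p.1 {b} a).vis ∩ (Current.explore rk p.2 {b'} a').vis).Nonempty} := by
  intro θ c C ε cW hθ hc hC hε hcW hθε hW hT
  obtain ⟨Cb, hCb, hB⟩ := stub_thetaBubble θ ε cW hθ hθε hcW hW
  obtain ⟨c₀, hc₀, hcmp⟩ := stub_backboneMomentComparison θ c C ε cW Cb hθ hc hC hε hcW hθε hCb hW hB
  refine ⟨c₀, hc₀, ?_⟩
  filter_upwards [hT, hcmp, eventually_ge_atTop 1] with L hTL hcmpL hL1
  obtain ⟨⟨hYn0, hYn1, hYn2, hYn3⟩, hY01, hY23, ⟨hYb0, hYb1, hYb2, hYb3⟩, hne01, hne23⟩ := source_geometry hL1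
  filter_upwards [hTL, hcmpL, eventually_ge_atTop (4 * L)] with n hTn hcmpn hn4
  obtain ⟨rk, hrk, h1, h2⟩ := hTn
  have hbox4 : box 3 (4 * L) ⊆ box 3 n := box_mono 3 hn4
  have hbox3 : box 3 (3 * L) ⊆ box 3 n := box_mono 3 (by omega)
  -- the four sources as box vertices
  set a : BoxVertex 3 n := ⟨(L : ℤ) • Y 0, box_subset_box_succ 3 n (hbox4 hYb0)⟩ with ha
  set b : BoxVertex 3 n := ⟨(L : ℤ) • Y 1, box_subset_box_succ 3 n (hbox4 hYb1)⟩ with hb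
  set a' : BoxVertex 3 n := ⟨(L : ℤ) • Y 2, box_subset_box_succ 3 n (hbox4 hYb2)⟩ with ha'
  set b' : BoxVertex 3 n := ⟨(L : ℤ) • Y 3, box_subset_box_succ 3 n (hbox4 hYb3)⟩ with hb'
  have hab : a ≠ b := fun h => hne01 (congrArg Subtype.val h)
  have hab' : a' ≠ b' := fun h => hne23 (congrArg Subtype.val h)
  refine ⟨rk, hrk, a, b, a', b', rfl, rfl, rfl, rfl, ?_⟩
  -- the backbone densities of the two independent currents
  set P₁ := currentLaw (freeBoxGraph 3 n) (criticalBeta 3) ({a} ∆ {b}) with hP₁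
  set P₂ := currentLaw (freeBoxGraph 3 n) (criticalBeta 3) ({a'} ∆ {b'}) with hP₂
  set f₁ : BoxVertex 3 n → ℝ := fun u => P₁.real {m | u ∈ (Current.explore rk m {b} a).vis} with hf₁
  set f₂ : BoxVertex 3 n → ℝ := fun u => P₂.real {m | u ∈ (Current.explore rk m {b'} a').vis} with hf₂
  set g₁ : BoxVertex 3 n → BoxVertex 3 n → ℝ :=
    fun u v => P₁.real {m | u ∈ (Current.explore rk m {b} a).vis ∧ v ∈ (Current.explore rk m {b} a).vis} with hg₁
  set g₂ : BoxVertex 3 n → BoxVertex 3 n → ℝ :=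
    fun u v => P₂.real {m | u ∈ (Current.explore rk m {b'} a').vis ∧ v ∈ (Current.explore rk m {b'} a').vis} with hg₂
  set A : Finset (BoxVertex 3 n) :=
    Finset.univ.filter (fun u : BoxVertex 3 n => ((u : Site 3) - (2 * (L : ℤ)) • (Pi.single 0 1 : Site 3)) ∈ box 3 L) with hA
  -- P1: Cauchy–Schwarz
  have hCS := stub_backboneCauchySchwarz n rk a b a' b' A
  -- the bounds on the densities, through the dictionary P2
  have hdiag : ∀ u : BoxVertex 3 n, g₁ u u = f₁ u ∧ g₂ u u = f₂ u := fun u => by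
    simp only [hg₁, hg₂, hf₁, hf₂, and_self]
  have hone : ∀ u : BoxVertex 3 n, ((u : Site 3) - (2 * (L : ℤ)) • (Pi.single 0 1 : Site 3)) ∈ box 3 L →
      c * (L : ℝ) ^ (-θ) * threePointRatio n (a : Site 3) (b : Site 3) (u : Site 3) ≤ f₁ u ∧
      c * (L : ℝ) ^ (-θ) * threePointRatio n (a' : Site 3) (b' : Site 3) (u : Site 3) ≤ f₂ u ∧
      0 ≤ g₁ u u ∧ g₁ u u ≤ f₁ u ∧ 0 ≤ g₂ u u ∧ g₂ u u ≤ f₂ u := by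
    intro u hu
    obtain ⟨⟨hu0, hu0'⟩, ⟨hu1, hu1'⟩, ⟨hu2, hu2'⟩, ⟨hu3, hu3'⟩, hubox⟩ := region_geometry hu
    have hubox' : (u : Site 3) ∈ box 3 n := hbox3 hubox
    have hκ : 0 ≤ c * (L : ℝ) ^ (-θ) := mul_nonneg hc.le (Real.rpow_nonneg (Nat.cast_nonneg L) _)
    have hd₁ := (stub_backboneDensityDictionary n rk a b u u _ hκ (hbox4 hYb0) (hbox4 hYb1) hubox' hubox' hab).1
      (h1 a b u hYn0 hYn1 hY01.1 hY01.2 hu0 hu0' hu1 hu1')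
    have hd₂ := (stub_backboneDensityDictionary n rk a' b' u u _ hκ (hbox4 hYb2) (hbox4 hYb3) hubox' hubox' hab').1
      (h1 a' b' u hYn2 hYn3 hY23.1 hY23.2 hu2 hu2' hu3 hu3')
    refine ⟨hd₁, hd₂, ?_, ?_, ?_, ?_⟩
    · exact measureReal_nonneg
    · exact (hdiag u).1.le
    · exact measureReal_nonneg
    · exact (hdiag u).2.le
  have htwo : ∀ u v : BoxVertex 3 n, u ≠ v →
      ((u : Site 3) - (2 * (L : ℤ)) • (Pi.single 0 1 : Site 3)) ∈ box 3 L →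
      ((v : Site 3) - (2 * (L : ℤ)) • (Pi.single 0 1 : Site 3)) ∈ box 3 L →
      0 ≤ g₁ u v ∧
      g₁ u v ≤ C * (L : ℝ) ^ (-θ) * ‖(u : Site 3) - (v : Site 3)‖ ^ (-θ) *
        twoStep n (a : Site 3) (b : Site 3) (u : Site 3) (v : Site 3) / boxG n (a : Site 3) (b : Site 3) ∧
      0 ≤ g₂ u v ∧
      g₂ u v ≤ C * (L : ℝ) ^ (-θ) * ‖(u : Site 3) - (v : Site 3)‖ ^ (-θ) *
        twoStep n (a' : Site 3) (b' : Site 3) (u : Site 3) (v : Site 3) / boxG n (a' : Site 3) (b' : Site 3) := by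
    intro u v huv hu hv
    obtain ⟨⟨hu0, hu0'⟩, ⟨hu1, hu1'⟩, ⟨hu2, hu2'⟩, ⟨hu3, hu3'⟩, hubox⟩ := region_geometry hu
    obtain ⟨⟨hv0, hv0'⟩, ⟨hv1, hv1'⟩, ⟨hv2, hv2'⟩, ⟨hv3, hv3'⟩, hvbox⟩ := region_geometry hv
    have huox' : (u : Site 3) ∈ box 3 n := hbox3 hubox
    have hvox' : (v : Site 3) ∈ box 3 n := hbox3 hvbox
    have hκ : 0 ≤ C * (L : ℝ) ^ (-θ) * ‖(u : Site 3) - (v : Site 3)‖ ^ (-θ) :=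
      mul_nonneg (mul_nonneg hC.le (Real.rpow_nonneg (Nat.cast_nonneg L) _)) (Real.rpow_nonneg (norm_nonneg _) _)
    have hd₁ := (stub_backboneDensityDictionary n rk a b u v _ hκ (hbox4 hYb0) (hbox4 hYb1) huox' hvox' hab).2
      (h2 a b u v huv hYn0 hYn1 hY01.1 hY01.2 hu0 hu0' hu1 hu1' hv0 hv0' hv1 hv1')
    have hd₂ := (stub_backboneDensityDictionary n rk a' b' u v _ hκ (hbox4 hYb2) (hbox4 hYb3) huox' hvox' hab').2
      (h2 a' b' u v huv hYn2 hYn3 hY23.1 hY23.2 hu2 hu2' hu3 hu3' hv2 hv2' hv3 hv3')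
    exact ⟨measureReal_nonneg, hd₁, measureReal_nonneg, hd₂⟩
  -- P3: moment comparison
  obtain ⟨hcmp', hpos⟩ := hcmpn a b a' b' rfl rfl rfl rfl f₁ f₂ g₁ g₂ hone htwo
  -- conclusion: c₀ ≤ P[Γ₁ ∩ Γ₂ ≠ ∅]
  have hG : 0 ≤ ∑ u ∈ A, ∑ v ∈ A, g₁ u v * g₂ u v :=
    Finset.sum_nonneg fun u _ => Finset.sum_nonneg fun v _ => mul_nonneg measureReal_nonneg measureReal_nonneg
  by_contra hlt
  push Not at hlt
  rcases hG.eq_or_lt with h0 | hGpos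
  · rw [← h0, mul_zero] at hCS
    have : ∑ u ∈ A, f₁ u * f₂ u = 0 := pow_eq_zero_iff two_ne_zero |>.1 (le_antisymm hCS (sq_nonneg _))
    exact hpos.ne' this
  · have h3 := mul_lt_mul_of_pos_right hlt hGpos
    linarith

end Glue

/-! ## Composition: the four stub STATEMENTS conclude the crux (sorry-free) -/

/-- The canonical injective shape `(0, 4e₁, 2e₁+3e₂, 2e₁-3e₂)` is injective. [folklore] -/
theorem shape_injective : Function.Injective (![0, (4 : ℤ) • Pi.single 0 1, (2 : ℤ) • Pi.single 0 1 + (3 : ℤ) • Pi.single 1 1, (2 : ℤ) • Pi.single 0 1 - (3 : ℤ) • Pi.single 1 1] : Fin 4 → Site 3) := by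
  decide

/-- **COMPOSITION (sorry-free).** Stubs 1–4, taken as STATEMENTS, imply the crux `WindowForcesU4`
(stated UNFOLDED; the registered theorems below conclude the two route decls by name): thinning exponent
`θ` (Stub 1) + admissible window exponent `ε > θ` (Stub 2) + Paley–Zygmund (Stub 3) ⇒ the two backbones
meet with probability `≥ c₀` eventually in `L, n` ⇒ (Stub 4) `merge ≥ c₀` along the canonical shape ⇒
Aizenman's far merging of the lattice Ursell function (`criticalUrsellFour_le_of_frequently_le_merge`,
landed) ⇒ `HasNontrivialU4 S` for every non-degenerate pointwise limit (item 4471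
`farMergingGivesU4_proof`, landed). [cite: AizenmanCMP1982, Prop. 5.3] -/
theorem windowForcesU4_of_stubs
    (hE :
    (∃ ε c : ℝ, 0 < ε ∧ 0 < c ∧ ∀ m n : ℕ, 1 ≤ m → m ≤ n → c * ((n : ℝ) / m) ^ (-((3:ℝ) / 2 - ε)) * criticalTwoPoint 3 (Pi.single 0 (m : ℤ)) ≤ criticalTwoPoint 3 (Pi.single 0 (n : ℤ))) →
      ∃ θ c C : ℝ, 0 ≤ θ ∧ 0 < c ∧ 0 < C ∧
      (∀ᶠ L : ℕ in atTop, ∀ᶠ n : ℕ in atTop,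
        ∃ rk : (freeBoxGraph 3 n).edgeFinset → ℕ, Function.Injective rk ∧
          (∀ a b u : BoxVertex 3 n, ‖(a : Site 3)‖ ≤ 8 * (L : ℝ) → ‖(b : Site 3)‖ ≤ 8 * (L : ℝ) →
            (L : ℝ) ≤ ‖(a : Site 3) - (b : Site 3)‖ → ‖(a : Site 3) - (b : Site 3)‖ ≤ 8 * (L : ℝ) →
            (L : ℝ) ≤ ‖(u : Site 3) - (a : Site 3)‖ → ‖(u : Site 3) - (a : Site 3)‖ ≤ 8 * (L : ℝ) →
            (L : ℝ) ≤ ‖(u : Site 3) - (b : Site 3)‖ → ‖(u : Site 3) - (b : Site 3)‖ ≤ 8 * (L : ℝ) →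
            ENNReal.ofReal (c * (L : ℝ) ^ (-θ)) *
                (ecurrentSum (fun _ : (freeBoxGraph 3 n).edgeFinset => criticalBeta 3) ({a} ∆ {u}) *
                  ecurrentSum (fun _ : (freeBoxGraph 3 n).edgeFinset => criticalBeta 3) ({u} ∆ {b})) ≤
              (∑' m : Current (freeBoxGraph 3 n),
                  (if m.sources = {a} ∆ {b} then m.eweight (fun _ => criticalBeta 3) else 0) *
                    (if u ∈ (Current.explore rk m {b} a).vis then 1 else 0)) *
                ecurrentSum (fun _ : (freeBoxGraph 3 n).edgeFinset => criticalBeta 3) ∅) ∧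
          (∀ a b u v : BoxVertex 3 n, u ≠ v → ‖(a : Site 3)‖ ≤ 8 * (L : ℝ) → ‖(b : Site 3)‖ ≤ 8 * (L : ℝ) →
            (L : ℝ) ≤ ‖(a : Site 3) - (b : Site 3)‖ → ‖(a : Site 3) - (b : Site 3)‖ ≤ 8 * (L : ℝ) →
            (L : ℝ) ≤ ‖(u : Site 3) - (a : Site 3)‖ → ‖(u : Site 3) - (a : Site 3)‖ ≤ 8 * (L : ℝ) →
            (L : ℝ) ≤ ‖(u : Site 3) - (b : Site 3)‖ → ‖(u : Site 3) - (b : Site 3)‖ ≤ 8 * (L : ℝ) →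
            (L : ℝ) ≤ ‖(v : Site 3) - (a : Site 3)‖ → ‖(v : Site 3) - (a : Site 3)‖ ≤ 8 * (L : ℝ) →
            (L : ℝ) ≤ ‖(v : Site 3) - (b : Site 3)‖ → ‖(v : Site 3) - (b : Site 3)‖ ≤ 8 * (L : ℝ) →
            (∑' m : Current (freeBoxGraph 3 n),
                (if m.sources = {a} ∆ {b} then m.eweight (fun _ => criticalBeta 3) else 0) *
                  (if u ∈ (Current.explore rk m {b} a).vis ∧ v ∈ (Current.explore rk m {b} a).vis then 1 else 0)) *
                ecurrentSum (fun _ : (freeBoxGraph 3 n).edgeFinset => criticalBeta 3) ∅ * ecurrentSum (fun _ : (freeBoxGraph 3 n).edgeFinset => criticalBeta 3) ∅ ≤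
              ENNReal.ofReal (C * (L : ℝ) ^ (-θ) * ‖(u : Site 3) - (v : Site 3)‖ ^ (-θ)) *
                (ecurrentSum (fun _ : (freeBoxGraph 3 n).edgeFinset => criticalBeta 3) ({a} ∆ {u}) * ecurrentSum (fun _ : (freeBoxGraph 3 n).edgeFinset => criticalBeta 3) ({u} ∆ {v}) * ecurrentSum (fun _ : (freeBoxGraph 3 n).edgeFinset => criticalBeta 3) ({v} ∆ {b}) +
                  ecurrentSum (fun _ : (freeBoxGraph 3 n).edgeFinset => criticalBeta 3) ({a} ∆ {v}) * ecurrentSum (fun _ : (freeBoxGraph 3 n).edgeFinset => criticalBeta 3) ({v} ∆ {u}) * ecurrentSum (fun _ : (freeBoxGraph 3 n).edgeFinset => criticalBeta 3) ({u} ∆ {b})))))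
    (hF :
    (∃ ε c : ℝ, 0 < ε ∧ 0 < c ∧ ∀ m n : ℕ, 1 ≤ m → m ≤ n → c * ((n : ℝ) / m) ^ (-((3:ℝ) / 2 - ε)) * criticalTwoPoint 3 (Pi.single 0 (m : ℤ)) ≤ criticalTwoPoint 3 (Pi.single 0 (n : ℤ))) →
      ∀ θ c C : ℝ, 0 ≤ θ → 0 < c → 0 < C →
      (∀ᶠ L : ℕ in atTop, ∀ᶠ n : ℕ in atTop,
        ∃ rk : (freeBoxGraph 3 n).edgeFinset → ℕ, Function.Injective rk ∧
          (∀ a b u : BoxVertex 3 n, ‖(a : Site 3)‖ ≤ 8 * (L : ℝ) → ‖(b : Site 3)‖ ≤ 8 * (L : ℝ) →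
            (L : ℝ) ≤ ‖(a : Site 3) - (b : Site 3)‖ → ‖(a : Site 3) - (b : Site 3)‖ ≤ 8 * (L : ℝ) →
            (L : ℝ) ≤ ‖(u : Site 3) - (a : Site 3)‖ → ‖(u : Site 3) - (a : Site 3)‖ ≤ 8 * (L : ℝ) →
            (L : ℝ) ≤ ‖(u : Site 3) - (b : Site 3)‖ → ‖(u : Site 3) - (b : Site 3)‖ ≤ 8 * (L : ℝ) →
            ENNReal.ofReal (c * (L : ℝ) ^ (-θ)) *
                (ecurrentSum (fun _ : (freeBoxGraph 3 n).edgeFinset => criticalBeta 3) ({a} ∆ {u}) *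
                  ecurrentSum (fun _ : (freeBoxGraph 3 n).edgeFinset => criticalBeta 3) ({u} ∆ {b})) ≤
              (∑' m : Current (freeBoxGraph 3 n),
                  (if m.sources = {a} ∆ {b} then m.eweight (fun _ => criticalBeta 3) else 0) *
                    (if u ∈ (Current.explore rk m {b} a).vis then 1 else 0)) *
                ecurrentSum (fun _ : (freeBoxGraph 3 n).edgeFinset => criticalBeta 3) ∅) ∧
          (∀ a b u v : BoxVertex 3 n, u ≠ v → ‖(a : Site 3)‖ ≤ 8 * (L : ℝ) → ‖(b : Site 3)‖ ≤ 8 * (L : ℝ) →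
            (L : ℝ) ≤ ‖(a : Site 3) - (b : Site 3)‖ → ‖(a : Site 3) - (b : Site 3)‖ ≤ 8 * (L : ℝ) →
            (L : ℝ) ≤ ‖(u : Site 3) - (a : Site 3)‖ → ‖(u : Site 3) - (a : Site 3)‖ ≤ 8 * (L : ℝ) →
            (L : ℝ) ≤ ‖(u : Site 3) - (b : Site 3)‖ → ‖(u : Site 3) - (b : Site 3)‖ ≤ 8 * (L : ℝ) →
            (L : ℝ) ≤ ‖(v : Site 3) - (a : Site 3)‖ → ‖(v : Site 3) - (a : Site 3)‖ ≤ 8 * (L : ℝ) →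
            (L : ℝ) ≤ ‖(v : Site 3) - (b : Site 3)‖ → ‖(v : Site 3) - (b : Site 3)‖ ≤ 8 * (L : ℝ) →
            (∑' m : Current (freeBoxGraph 3 n),
                (if m.sources = {a} ∆ {b} then m.eweight (fun _ => criticalBeta 3) else 0) *
                  (if u ∈ (Current.explore rk m {b} a).vis ∧ v ∈ (Current.explore rk m {b} a).vis then 1 else 0)) *
                ecurrentSum (fun _ : (freeBoxGraph 3 n).edgeFinset => criticalBeta 3) ∅ * ecurrentSum (fun _ : (freeBoxGraph 3 n).edgeFinset => criticalBeta 3) ∅ ≤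
              ENNReal.ofReal (C * (L : ℝ) ^ (-θ) * ‖(u : Site 3) - (v : Site 3)‖ ^ (-θ)) *
                (ecurrentSum (fun _ : (freeBoxGraph 3 n).edgeFinset => criticalBeta 3) ({a} ∆ {u}) * ecurrentSum (fun _ : (freeBoxGraph 3 n).edgeFinset => criticalBeta 3) ({u} ∆ {v}) * ecurrentSum (fun _ : (freeBoxGraph 3 n).edgeFinset => criticalBeta 3) ({v} ∆ {b}) +
                  ecurrentSum (fun _ : (freeBoxGraph 3 n).edgeFinset => criticalBeta 3) ({a} ∆ {v}) * ecurrentSum (fun _ : (freeBoxGraph 3 n).edgeFinset => criticalBeta 3) ({v} ∆ {u}) * ecurrentSum (fun _ : (freeBoxGraph 3 n).edgeFinset => criticalBeta 3) ({u} ∆ {b})))) →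
      ∃ ε cW : ℝ, 0 < ε ∧ 0 < cW ∧
        (∀ m n : ℕ, 1 ≤ m → m ≤ n → cW * ((n : ℝ) / m) ^ (-((3:ℝ) / 2 - ε)) * criticalTwoPoint 3 (Pi.single 0 (m : ℤ)) ≤ criticalTwoPoint 3 (Pi.single 0 (n : ℤ))) ∧ θ < ε)
    (hP :
    ∀ θ c C ε cW : ℝ, 0 ≤ θ → 0 < c → 0 < C → 0 < ε → 0 < cW → θ < ε →
      (∀ m n : ℕ, 1 ≤ m → m ≤ n → cW * ((n : ℝ) / m) ^ (-((3:ℝ) / 2 - ε)) * criticalTwoPoint 3 (Pi.single 0 (m : ℤ)) ≤ criticalTwoPoint 3 (Pi.single 0 (n : ℤ))) →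
      (∀ᶠ L : ℕ in atTop, ∀ᶠ n : ℕ in atTop,
        ∃ rk : (freeBoxGraph 3 n).edgeFinset → ℕ, Function.Injective rk ∧
          (∀ a b u : BoxVertex 3 n, ‖(a : Site 3)‖ ≤ 8 * (L : ℝ) → ‖(b : Site 3)‖ ≤ 8 * (L : ℝ) →
            (L : ℝ) ≤ ‖(a : Site 3) - (b : Site 3)‖ → ‖(a : Site 3) - (b : Site 3)‖ ≤ 8 * (L : ℝ) →
            (L : ℝ) ≤ ‖(u : Site 3) - (a : Site 3)‖ → ‖(u : Site 3) - (a : Site 3)‖ ≤ 8 * (L : ℝ) →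
            (L : ℝ) ≤ ‖(u : Site 3) - (b : Site 3)‖ → ‖(u : Site 3) - (b : Site 3)‖ ≤ 8 * (L : ℝ) →
            ENNReal.ofReal (c * (L : ℝ) ^ (-θ)) *
                (ecurrentSum (fun _ : (freeBoxGraph 3 n).edgeFinset => criticalBeta 3) ({a} ∆ {u}) *
                  ecurrentSum (fun _ : (freeBoxGraph 3 n).edgeFinset => criticalBeta 3) ({u} ∆ {b})) ≤
              (∑' m : Current (freeBoxGraph 3 n),
                  (if m.sources = {a} ∆ {b} then m.eweight (fun _ => criticalBeta 3) else 0) *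
                    (if u ∈ (Current.explore rk m {b} a).vis then 1 else 0)) *
                ecurrentSum (fun _ : (freeBoxGraph 3 n).edgeFinset => criticalBeta 3) ∅) ∧
          (∀ a b u v : BoxVertex 3 n, u ≠ v → ‖(a : Site 3)‖ ≤ 8 * (L : ℝ) → ‖(b : Site 3)‖ ≤ 8 * (L : ℝ) →
            (L : ℝ) ≤ ‖(a : Site 3) - (b : Site 3)‖ → ‖(a : Site 3) - (b : Site 3)‖ ≤ 8 * (L : ℝ) →
            (L : ℝ) ≤ ‖(u : Site 3) - (a : Site 3)‖ → ‖(u : Site 3) - (a : Site 3)‖ ≤ 8 * (L : ℝ) →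
            (L : ℝ) ≤ ‖(u : Site 3) - (b : Site 3)‖ → ‖(u : Site 3) - (b : Site 3)‖ ≤ 8 * (L : ℝ) →
            (L : ℝ) ≤ ‖(v : Site 3) - (a : Site 3)‖ → ‖(v : Site 3) - (a : Site 3)‖ ≤ 8 * (L : ℝ) →
            (L : ℝ) ≤ ‖(v : Site 3) - (b : Site 3)‖ → ‖(v : Site 3) - (b : Site 3)‖ ≤ 8 * (L : ℝ) →
            (∑' m : Current (freeBoxGraph 3 n),
                (if m.sources = {a} ∆ {b} then m.eweight (fun _ => criticalBeta 3) else 0) *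
                  (if u ∈ (Current.explore rk m {b} a).vis ∧ v ∈ (Current.explore rk m {b} a).vis then 1 else 0)) *
                ecurrentSum (fun _ : (freeBoxGraph 3 n).edgeFinset => criticalBeta 3) ∅ * ecurrentSum (fun _ : (freeBoxGraph 3 n).edgeFinset => criticalBeta 3) ∅ ≤
              ENNReal.ofReal (C * (L : ℝ) ^ (-θ) * ‖(u : Site 3) - (v : Site 3)‖ ^ (-θ)) *
                (ecurrentSum (fun _ : (freeBoxGraph 3 n).edgeFinset => criticalBeta 3) ({a} ∆ {u}) * ecurrentSum (fun _ : (freeBoxGraph 3 n).edgeFinset => criticalBeta 3) ({u} ∆ {v}) * ecurrentSum (fun _ : (freeBoxGraph 3 n).edgeFinset => criticalBeta 3) ({v} ∆ {b}) +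
                  ecurrentSum (fun _ : (freeBoxGraph 3 n).edgeFinset => criticalBeta 3) ({a} ∆ {v}) * ecurrentSum (fun _ : (freeBoxGraph 3 n).edgeFinset => criticalBeta 3) ({v} ∆ {u}) * ecurrentSum (fun _ : (freeBoxGraph 3 n).edgeFinset => criticalBeta 3) ({u} ∆ {b})))) →
      ∃ c₀ : ℝ, 0 < c₀ ∧ ∀ᶠ L : ℕ in atTop, ∀ᶠ n : ℕ in atTop,
        ∃ rk : (freeBoxGraph 3 n).edgeFinset → ℕ, Function.Injective rk ∧
          ∃ a b a' b' : BoxVertex 3 n,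
            (a : Site 3) = (L : ℤ) • (![0, (4 : ℤ) • Pi.single 0 1, (2 : ℤ) • Pi.single 0 1 + (3 : ℤ) • Pi.single 1 1, (2 : ℤ) • Pi.single 0 1 - (3 : ℤ) • Pi.single 1 1] : Fin 4 → Site 3) 0 ∧
            (b : Site 3) = (L : ℤ) • (![0, (4 : ℤ) • Pi.single 0 1, (2 : ℤ) • Pi.single 0 1 + (3 : ℤ) • Pi.single 1 1, (2 : ℤ) • Pi.single 0 1 - (3 : ℤ) • Pi.single 1 1] : Fin 4 → Site 3) 1 ∧
            (a' : Site 3) = (L : ℤ) • (![0, (4 : ℤ) • Pi.single 0 1, (2 : ℤ) • Pi.single 0 1 + (3 : ℤ) • Pi.single 1 1, (2 : ℤ) • Pi.single 0 1 - (3 : ℤ) • Pi.single 1 1] : Fin 4 → Site 3) 2 ∧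
            (b' : Site 3) = (L : ℤ) • (![0, (4 : ℤ) • Pi.single 0 1, (2 : ℤ) • Pi.single 0 1 + (3 : ℤ) • Pi.single 1 1, (2 : ℤ) • Pi.single 0 1 - (3 : ℤ) • Pi.single 1 1] : Fin 4 → Site 3) 3 ∧
            c₀ ≤ (doubleCurrentMeasure (freeBoxGraph 3 n) (criticalBeta 3) ({a} ∆ {b}) ({a'} ∆ {b'})).real
              {p | ((Current.explore rk p.1 {b} a).vis ∩ (Current.explore rk p.2 {b'} a').vis).Nonempty})
    (hM :
    ∀ y : Fin 4 → Site 3, Function.Injective y → ∀ (L n : ℕ)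
      (rk : (freeBoxGraph 3 n).edgeFinset → ℕ) (a b a' b' : BoxVertex 3 n),
      (a : Site 3) = (L : ℤ) • y 0 → (b : Site 3) = (L : ℤ) • y 1 →
      (a' : Site 3) = (L : ℤ) • y 2 → (b' : Site 3) = (L : ℤ) • y 3 → 1 ≤ L →
      (doubleCurrentMeasure (freeBoxGraph 3 n) (criticalBeta 3) ({a} ∆ {b}) ({a'} ∆ {b'})).real
          {p | ((Current.explore rk p.1 {b} a).vis ∩ (Current.explore rk p.2 {b'} a').vis).Nonempty} ≤
        merge n (fun i => (L : ℤ) • y i)) :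
    (∃ ε c : ℝ, 0 < ε ∧ 0 < c ∧ ∀ m n : ℕ, 1 ≤ m → m ≤ n → c * ((n : ℝ) / m) ^ (-((3:ℝ) / 2 - ε)) * criticalTwoPoint 3 (Pi.single 0 (m : ℤ)) ≤ criticalTwoPoint 3 (Pi.single 0 (n : ℤ))) →
      ∀ (ρ : ℝ → ℝ) (S : CorrFamily 3), (∀ δ ∈ Set.Ioc (0:ℝ) 1, 0 < ρ δ) →
      HasPointwiseScalingLimit (criticalCorr 3) ρ S → IsNondegenerateTwoPoint S → HasNontrivialU4 S := by
  intro hW ρ S hρ hlim hnd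
  obtain ⟨θ, c, C, hθ, hc, hC, hT⟩ := hE hW
  obtain ⟨ε, cW, hε, hcW, hWp, hθε⟩ := hF hW θ c C hθ hc hC hT
  obtain ⟨c₀, hc₀, hev⟩ := hP θ c C ε cW hθ hc hC hε hcW hθε hWp hT
  -- two-current merging is non-degenerate along the canonical shape, eventually in `L` and `n`
  have hmerge : ∀ᶠ L : ℕ in atTop, ∀ᶠ n : ℕ in atTop,
      c₀ ≤ merge n (fun i => (L : ℤ) • (![0, (4 : ℤ) • Pi.single 0 1, (2 : ℤ) • Pi.single 0 1 + (3 : ℤ) • Pi.single 1 1, (2 : ℤ) • Pi.single 0 1 - (3 : ℤ) • Pi.single 1 1] : Fin 4 → Site 3) i) := by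
    filter_upwards [hev, eventually_ge_atTop 1] with L hL hL1
    filter_upwards [hL] with n hn
    obtain ⟨rk, -, a, b, a', b', ha, hb, ha', hb', hle⟩ := hn
    exact hle.trans (hM _ shape_injective L n rk a b a' b' ha hb ha' hb' hL1)
  -- transfer to every non-degenerate pointwise scaling limit (item stmt-4471, landed)
  have hFG := Summit.CriticalPhenomena.Ising3DConformalLimit.FKParityRobustnessFarMergingGivesU4.farMergingGivesU4_proof
  unfold Summit.CriticalPhenomena.Ising3DConformalLimit.Theses.FKParityRobustness.FarMergingGivesU4 at hFG
  refine hFG ⟨2 * c₀, by positivity, (![0, (4 : ℤ) • Pi.single 0 1, (2 : ℤ) • Pi.single 0 1 + (3 : ℤ) • Pi.single 1 1, (2 : ℤ) • Pi.single 0 1 - (3 : ℤ) • Pi.single 1 1] : Fin 4 → Site 3), shape_injective, fun L₀ => ?_⟩ ρ S hρ hlim hnd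
  -- Aizenman's far merging of the lattice Ursell function at a dilation `L ≥ L₀`
  obtain ⟨L, hL₀, hL⟩ := ((eventually_ge_atTop L₀).and hmerge).exists
  exact ⟨L, hL₀, criticalUrsellFour_le_of_frequently_le_merge (fun i => (L : ℤ) • (![0, (4 : ℤ) • Pi.single 0 1, (2 : ℤ) • Pi.single 0 1 + (3 : ℤ) • Pi.single 1 1, (2 : ℤ) • Pi.single 0 1 - (3 : ℤ) • Pi.single 1 1] : Fin 4 → Site 3) i) hL.frequently⟩

/-! ## The skeleton theorems (registered shape: the crux BY NAME, no hypotheses, `sorry` only via the stubs) -/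

/-- **`WindowForcesU4_of`** — the crux decl of route `CoerciveSharpness` (item stmt-CriticalPhenomena-5505),
from the four stubs via the sorry-free composition. [cite: AizenmanCMP1982, Prop. 5.3] -/
theorem WindowForcesU4_of :
    Summit.CriticalPhenomena.Ising3DConformalLimit.Theses.CoerciveSharpness.WindowForcesU4 :=
  windowForcesU4_of_stubs stub_backboneExponent stub_backboneFat backbonePZ stub_mergeOfBackbonesMeet

/-- **`WindowForcesU4_of_latticeSDP`** — the same for the `LatticeSDPCertificates` copy of the shared decl.
[cite: AizenmanCMP1982, Prop. 5.3] -/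
theorem WindowForcesU4_of_latticeSDP :
    Summit.CriticalPhenomena.Ising3DConformalLimit.Theses.LatticeSDPCertificates.WindowForcesU4 :=
  windowForcesU4_of_stubs stub_backboneExponent stub_backboneFat backbonePZ stub_mergeOfBackbonesMeet

end Summit.CriticalPhenomena.Ising3DConformalLimit.Cruxes.WindowForcesU4.BackboneThinningWindow

end
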